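import Mathlib
import HarnessLib
import Summits.HubbardSuperconductivity.HubbardSuperconductivity.Theorems.KLProgrammeKLRegimeSplitPhValueModuli
import Summits.HubbardSuperconductivity.HubbardSuperconductivity.Theorems.KLProgrammeKLRegimeSplitPhExchangeShift

/-!
# Route `KLProgramme` — ENGINE (stmt-HubbardSuperconductivity-20437 `KLRegimeEngineV17F2`), row (c) binder #8 (★ v19 `hexLadMV`), the EXCHANGE p-h row `RQ` IN THE ROWS DOOR'S LITERAL
# SHAPE: the partner sum `Σ_{p′}[matsubaraInt p′.1 + matsubaraInt ω₀ + matsubaraInt ω₀ + 1 = matsubaraInt p.1 ∧ p′.2 = p.2 + Qm − x − y]` COLLAPSES to the single partner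
# `p⁻ = (σ p.1, p.2 + Qm − x − y)`, `σ` = the DOWN-SHIFT of the Matsubara label by one (`ω ↦ ω − 2π/β`), absent at the bottom label — brick O6g (structure), sequel of O6d/O6f
# (cell gate-hubbard-kl, seat hubbard-kl-k3c2-p2 g32, technique «thermal-bar induction n ≤ nScales β + 1 with EngineBoundsAtV4S sums»)

WHY.  E1-LEDGER rev 13/14 line #8: the exchange row `RQ` of binder #8 at the exchanged pinned pair is «the same spatial object with the partner frequency shifted by the pinned
transfer — rotation part + a resolvent-identity correction `∝ (π/β)/Λ` = thermal».  The rows door (`klmd_defect_le_rows_family`, hypothesis `hQ`) spells the partner through the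
constraint above; since `matsubaraInt ω₀ = 0` (`matsubaraInt_omega0`) it reads `matsubaraInt p′.1 = matsubaraInt p.1 − 1`: the partner label is the predecessor of `p.1`, which
exists iff `p.1` is not the bottom label (`(p.1 : ℕ) ≠ 0`), and then its frequency is `ω_{p.1} − 2π/β`.  This file fixes that bookkeeping once:

* `klph_exists_shiftIdx` — there is `σ : MatsubaraIdx M → MatsubaraIdx M` with `matsubaraInt (σ ν) = matsubaraInt ν − 1` off the bottom label and `σ ν = ν` at it (no `def`:
  an `∃`, the consumer `obtain`s it);
* `klph_shift_freq_eq` / `klph_abs_shift_freq_sub_le` — for such `σ`: `ω_{σν} = ω_ν − 2π/β` off the bottom, `|ω_{σν} − ω_ν| ≤ 2π/β` everywhere (`0 < β`) — the `q₀` of O6d's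
  `klod_exchange_bubble_sub_direct_le`;
* **`klph_exchange_partner_sum_collapse`** — `Σ_{p′}[constraint]·f p′ = if (p.1 : ℕ) = 0 then 0 else f (σ p.1, p.2 + Qm − x − y)`;
* **`klph_exchangeRow_eq`** — the rows door's `hQ` object, for any kernel product `F`, equals the single sum
  `Σ_p [p.1 ≠ bottom]·((Φĝ)(p)(Ẇĝ)(p⁻) + (Ẇĝ)(p)(Φĝ)(p⁻))·F p p⁻`;
* `klph_exchangeRow_diag_eq` — at the exchange diagonal `Qm = x + y`: `p⁻ = (σ p.1, p.2)`, zero spatial transfer, partner frequency `ω − 2π/β`.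
The bound (rotation + O6d's one-more-rung correction + moduli) composes these with O6c/O6e exactly as O6f does for `RP`; it is the next brick.  Pure finite-sum algebra; no
definitions; nothing asserts (c), K3 or superconductivity.  [cite: BenfattoGiulianiMastropietro2006, §2.5]
-/

noncomputable section

namespace Summit.HubbardSuperconductivity.HubbardSuperconductivity.Theorems.KLRegimeSplit

set_option linter.dupNamespace false -- summit = problem name (single-conjunct summit), D-0017

open Real Set Finset Literature.MathematicalPhysics.QuantumLattice
open Literature.Probability.LatticeModels hiding torusSupNorm
open Summit.HubbardSuperconductivity.HubbardSuperconductivity.Theorems.TwoPointAssembly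
open Summit.HubbardSuperconductivity.HubbardSuperconductivity.Theorems.KLProgrammeLegKernels
open Summit.HubbardSuperconductivity.HubbardSuperconductivity.Theorems.KLRegimeWick
open Summit.HubbardSuperconductivity.HubbardSuperconductivity.Theorems.EngineV8
open Summit.HubbardSuperconductivity.HubbardSuperconductivity.Theorems.DispersionFlow

variable {L M : ℕ} [NeZero L] [NeZero M]

/-! ## §1 The down-shift of the Matsubara label -/

omit [NeZero L] in
/-- **The down-shift exists**: a self-map `σ` of the Matsubara labels with `matsubaraInt (σ ν) = matsubaraInt ν − 1` off the bottom label (`(ν : ℕ) ≠ 0`) and `σ ν = ν` at it. -/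
theorem klph_exists_shiftIdx (M : ℕ) [NeZero M] :
    ∃ σ : MatsubaraIdx M → MatsubaraIdx M,
      (∀ ν : MatsubaraIdx M, (ν : ℕ) ≠ 0 → matsubaraInt M (σ ν) = matsubaraInt M ν - 1) ∧ (∀ ν : MatsubaraIdx M, (ν : ℕ) = 0 → σ ν = ν) := by
  refine ⟨fun ν => if h : (ν : ℕ) = 0 then ν else ⟨(ν : ℕ) - 1, by have := ν.isLt; omega⟩, fun ν hν => ?_, fun ν hν => ?_⟩
  · simp only [hν, ↓reduceDIte, matsubaraInt]
    have h1 : 1 ≤ (ν : ℕ) := Nat.one_le_iff_ne_zero.mpr hν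
    push_cast [Nat.cast_sub h1]
    ring
  · simp only [hν, ↓reduceDIte]

omit [NeZero L] [NeZero M] in
/-- **The shifted frequency**: `ω_{σν} = ω_ν − 2π/β` off the bottom label. -/
theorem klph_shift_freq_eq (β : ℝ) {σ : MatsubaraIdx M → MatsubaraIdx M}
    (hσ : ∀ ν : MatsubaraIdx M, (ν : ℕ) ≠ 0 → matsubaraInt M (σ ν) = matsubaraInt M ν - 1) {ν : MatsubaraIdx M} (hν : (ν : ℕ) ≠ 0) :
    matsubaraFreq β M (σ ν) = matsubaraFreq β M ν - 2 * π / β := by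
  simp only [matsubaraFreq, hσ ν hν]
  push_cast
  ring

omit [NeZero L] [NeZero M] in
/-- **The shift is thermal**: `|ω_{σν} − ω_ν| ≤ 2π/β` for every label (`0 < β`) — the `q₀` of `klod_exchange_bubble_sub_direct_le`. -/
theorem klph_abs_shift_freq_sub_le {β : ℝ} (hβ : 0 < β) {σ : MatsubaraIdx M → MatsubaraIdx M}
    (hσ : ∀ ν : MatsubaraIdx M, (ν : ℕ) ≠ 0 → matsubaraInt M (σ ν) = matsubaraInt M ν - 1) (hσ0 : ∀ ν : MatsubaraIdx M, (ν : ℕ) = 0 → σ ν = ν)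
    (ν : MatsubaraIdx M) : |matsubaraFreq β M (σ ν) - matsubaraFreq β M ν| ≤ 2 * π / β := by
  by_cases hν : (ν : ℕ) = 0
  · rw [hσ0 ν hν, sub_self, abs_zero]; positivity
  · rw [klph_shift_freq_eq β hσ hν, show matsubaraFreq β M ν - 2 * π / β - matsubaraFreq β M ν = -(2 * π / β) by ring, abs_neg,
      abs_of_pos (by positivity)]

omit [NeZero L] [NeZero M] in
/-- At the bottom label no predecessor exists: `matsubaraInt p′ + 1 ≠ matsubaraInt ν` when `(ν : ℕ) = 0`. -/
theorem klph_matsubaraInt_add_one_ne_of_bottom {ν : MatsubaraIdx M} (hν : (ν : ℕ) = 0) (ν' : MatsubaraIdx M) :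
    matsubaraInt M ν' + 1 ≠ matsubaraInt M ν := by
  simp only [matsubaraInt, hν, CharP.cast_eq_zero, zero_sub]
  have : (0 : ℤ) ≤ (ν' : ℕ) := Int.natCast_nonneg _
  omega

/-! ## §2 The exchange partner sum collapses -/

omit [NeZero M] in
/-- **The exchange partner constraint fixes `p′`** (or kills the term at the bottom label): for any `f`, pair momentum `Qm` and sites `x y`,
`Σ_{p′}[matsubaraInt p′.1 + matsubaraInt ω₀ + matsubaraInt ω₀ + 1 = matsubaraInt p.1 ∧ p′.2 = p.2 + Qm − x − y]·f p′ = if (p.1 : ℕ) = 0 then 0 else f (σ p.1, p.2 + Qm − x − y)`. -/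
theorem klph_exchange_partner_sum_collapse [NeZero M] {σ : MatsubaraIdx M → MatsubaraIdx M}
    (hσ : ∀ ν : MatsubaraIdx M, (ν : ℕ) ≠ 0 → matsubaraInt M (σ ν) = matsubaraInt M ν - 1)
    (f : FreqMomentum L M → ℂ) (p : FreqMomentum L M) (Qm x y : TorusSite 2 L) :
    (∑ p' : FreqMomentum L M,
        if matsubaraInt M p'.1 + matsubaraInt M (omega0 M) + matsubaraInt M (omega0 M) + 1 = matsubaraInt M p.1 ∧ p'.2 = p.2 + Qm - x - y then f p' else 0) =
      if (p.1 : ℕ) = 0 then 0 else f (σ p.1, p.2 + Qm - x - y) := by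
  simp only [matsubaraInt_omega0, add_zero]
  by_cases hp : (p.1 : ℕ) = 0
  · rw [if_pos hp]
    refine sum_eq_zero fun p' _ => ?_
    rw [if_neg]
    exact fun h => klph_matsubaraInt_add_one_ne_of_bottom hp p'.1 h.1
  · rw [if_neg hp]
    have hiff : ∀ p' : FreqMomentum L M,
        (matsubaraInt M p'.1 + 1 = matsubaraInt M p.1 ∧ p'.2 = p.2 + Qm - x - y) ↔ p' = (σ p.1, p.2 + Qm - x - y) := by
      intro p'
      constructor
      · rintro ⟨h1, h2⟩
        have h1' : matsubaraInt M p'.1 = matsubaraInt M (σ p.1) := by rw [hσ p.1 hp]; linarith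
        exact Prod.ext (matsubaraInt_injective M h1') h2
      · rintro rfl
        refine ⟨?_, rfl⟩
        simp only [hσ p.1 hp]
        ring
    simp_rw [hiff]
    rw [Finset.sum_ite_eq']
    simp

/-! ## §3 The exchange row as a single sum over the shifted pair -/

omit [NeZero M] in
/-- **The exchange p-h row, collapsed**: with `p⁻ := (σ p.1, p.2 + Qm − x − y)`, the rows door's `hQ` object equals
`Σ_p [p.1 ≠ bottom]·((Φĝ)(p)(Ẇĝ)(p⁻) + (Ẇĝ)(p)(Φĝ)(p⁻))·F p p⁻`. -/
theorem klph_exchangeRow_eq [NeZero M] {σ : MatsubaraIdx M → MatsubaraIdx M}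
    (hσ : ∀ ν : MatsubaraIdx M, (ν : ℕ) ≠ 0 → matsubaraInt M (σ ν) = matsubaraInt M ν - 1)
    (β μ : ℝ) (K : TrigPolyC4v) (Φw Wdw : FreqMomentum L M → ℝ) (F : FreqMomentum L M → FreqMomentum L M → ℂ) (Qm x y : TorusSite 2 L) :
    (∑ p : FreqMomentum L M, ∑ p' : FreqMomentum L M,
        if matsubaraInt M p'.1 + matsubaraInt M (omega0 M) + matsubaraInt M (omega0 M) + 1 = matsubaraInt M p.1 ∧ p'.2 = p.2 + Qm - x - y then
          ((((Φw p : ℝ) : ℂ) * (((β * (L : ℝ) ^ 2 : ℝ) : ℂ) * propCT L M β μ K p)) * (((Wdw p' : ℝ) : ℂ) * (((β * (L : ℝ) ^ 2 : ℝ) : ℂ) * propCT L M β μ K p')) +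
            (((Wdw p : ℝ) : ℂ) * (((β * (L : ℝ) ^ 2 : ℝ) : ℂ) * propCT L M β μ K p)) * (((Φw p' : ℝ) : ℂ) * (((β * (L : ℝ) ^ 2 : ℝ) : ℂ) * propCT L M β μ K p'))) *
            F p p'
        else 0) =
      ∑ p : FreqMomentum L M,
        if (p.1 : ℕ) = 0 then 0 else
          ((((Φw p : ℝ) : ℂ) * (((β * (L : ℝ) ^ 2 : ℝ) : ℂ) * propCT L M β μ K p)) *
                (((Wdw (σ p.1, p.2 + Qm - x - y) : ℝ) : ℂ) * (((β * (L : ℝ) ^ 2 : ℝ) : ℂ) * propCT L M β μ K (σ p.1, p.2 + Qm - x - y))) +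
              (((Wdw p : ℝ) : ℂ) * (((β * (L : ℝ) ^ 2 : ℝ) : ℂ) * propCT L M β μ K p)) *
                (((Φw (σ p.1, p.2 + Qm - x - y) : ℝ) : ℂ) * (((β * (L : ℝ) ^ 2 : ℝ) : ℂ) * propCT L M β μ K (σ p.1, p.2 + Qm - x - y)))) *
            F p (σ p.1, p.2 + Qm - x - y) := by
  refine sum_congr rfl fun p _ => ?_
  exact klph_exchange_partner_sum_collapse hσ (fun p' => ((((Φw p : ℝ) : ℂ) * (((β * (L : ℝ) ^ 2 : ℝ) : ℂ) * propCT L M β μ K p)) *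
      (((Wdw p' : ℝ) : ℂ) * (((β * (L : ℝ) ^ 2 : ℝ) : ℂ) * propCT L M β μ K p')) +
    (((Wdw p : ℝ) : ℂ) * (((β * (L : ℝ) ^ 2 : ℝ) : ℂ) * propCT L M β μ K p)) * (((Φw p' : ℝ) : ℂ) * (((β * (L : ℝ) ^ 2 : ℝ) : ℂ) * propCT L M β μ K p'))) *
    F p p') p Qm x y

omit [NeZero M] in
/-- **At the exchange diagonal `Qm = x + y` the partner has the SAME momentum**: `p⁻ = (σ p.1, p.2)` — zero spatial transfer, partner frequency `ω_p − 2π/β`. -/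
theorem klph_exchangeRow_diag_eq [NeZero M] {σ : MatsubaraIdx M → MatsubaraIdx M}
    (hσ : ∀ ν : MatsubaraIdx M, (ν : ℕ) ≠ 0 → matsubaraInt M (σ ν) = matsubaraInt M ν - 1)
    (β μ : ℝ) (K : TrigPolyC4v) (Φw Wdw : FreqMomentum L M → ℝ) (F : FreqMomentum L M → FreqMomentum L M → ℂ) {Qm x y : TorusSite 2 L}
    (hxy : Qm = x + y) :
    (∑ p : FreqMomentum L M, ∑ p' : FreqMomentum L M,
        if matsubaraInt M p'.1 + matsubaraInt M (omega0 M) + matsubaraInt M (omega0 M) + 1 = matsubaraInt M p.1 ∧ p'.2 = p.2 + Qm - x - y then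
          ((((Φw p : ℝ) : ℂ) * (((β * (L : ℝ) ^ 2 : ℝ) : ℂ) * propCT L M β μ K p)) * (((Wdw p' : ℝ) : ℂ) * (((β * (L : ℝ) ^ 2 : ℝ) : ℂ) * propCT L M β μ K p')) +
            (((Wdw p : ℝ) : ℂ) * (((β * (L : ℝ) ^ 2 : ℝ) : ℂ) * propCT L M β μ K p)) * (((Φw p' : ℝ) : ℂ) * (((β * (L : ℝ) ^ 2 : ℝ) : ℂ) * propCT L M β μ K p'))) *
            F p p'
        else 0) =
      ∑ p : FreqMomentum L M,
        if (p.1 : ℕ) = 0 then 0 else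
          ((((Φw p : ℝ) : ℂ) * (((β * (L : ℝ) ^ 2 : ℝ) : ℂ) * propCT L M β μ K p)) *
                (((Wdw (σ p.1, p.2) : ℝ) : ℂ) * (((β * (L : ℝ) ^ 2 : ℝ) : ℂ) * propCT L M β μ K (σ p.1, p.2))) +
              (((Wdw p : ℝ) : ℂ) * (((β * (L : ℝ) ^ 2 : ℝ) : ℂ) * propCT L M β μ K p)) *
                (((Φw (σ p.1, p.2) : ℝ) : ℂ) * (((β * (L : ℝ) ^ 2 : ℝ) : ℂ) * propCT L M β μ K (σ p.1, p.2)))) *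
            F p (σ p.1, p.2) := by
  rw [klph_exchangeRow_eq hσ β μ K Φw Wdw F Qm x y]
  refine sum_congr rfl fun p _ => ?_
  have hp : p.2 + Qm - x - y = p.2 := by rw [hxy]; abel
  rw [hp]

end Summit.HubbardSuperconductivity.HubbardSuperconductivity.Theorems.KLRegimeSplit

end
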